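import Summits.ResolutionOfSingularities.ResolutionOfSingularities.Theorems.HilbertSamuelEliminationSigmaMaxModificationsLevelRaising
import Mathlib.AlgebraicGeometry.Noetherian
import HarnessLib

/-!
# The open core reduces to the single level `N = dim X`
# (crux `SigmaMaxModifications`, stmt-ResolutionOfSingularities-18506, line `Sketch`)

The crux, and the lead skeleton's open core stub `stub_nuEliminationsExist`, quantify over ALL
levels `N ≥ dim X` of the Hilbert–Samuel function `H^N` (CJS Def. 2.28). By level raising
(`nuEliminationsExist_succ`, landed: a `ν`-elimination at level `N` of a scheme of dimension
`≤ N` is one at level `N + 1`, partial summation being monotone and injective and maximal values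
transferring DOWN one level — refuter kit `SigmaMaxModifications.Negative.Levels`) the statement
at the EXACT level `N = dim X` implies it at every level: `nuEliminationsExist_of_level_eq_dim`.
So the binding level of the crux is `N = dim X`: the level at which `X_max` is largest
(`hsMaxLocus_succ_subset`), which the route's Assembly never uses (it runs the tower at
`N = dim X + 1`), and at which the tree's Bennett–Hironaka inequality (`H^{(s+1+d)}[R_𝔭] ≤
H^{(s+1)}[R]`, `BennettHironakaLocal.lean`; point blow-ups need `ψ_X(x) < N`,
`PointBlowupHsFunMono.lean`) is not available — the sharp `H^{(0)}` form (Singh 1974) is.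
PLANNER NOTE recorded with the lemma: restating the crux with `topologicalKrullDim X < N`
(as was done for `MaxLocusNowhereDense`) loses nothing downstream.

## Sources

* V. Cossart, U. Jannsen, S. Saito, LNM 2270 (2020), Def. 2.28, Rem. 2.29, Def. 6.14.
  [CossartJannsenSaito2020]
-/

set_option linter.dupNamespace false -- mandated namespace of this single-conjunct summit

noncomputable section

open CategoryTheory AlgebraicGeometry TopologicalSpace
open Literature.AlgebraicGeometry.Resolution Literature.RingTheory.HilbertSamuel

namespace Summit.ResolutionOfSingularities.ResolutionOfSingularities.Theorems.SigmaMaxModifications.Sketch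

/-- A dimension bound `dim X ≤ m + 1` (in `WithBot ℕ∞`) splits as `dim X = m + 1` or
`dim X ≤ m`. [folklore] -/
theorem topologicalKrullDim_eq_or_le_of_le_succ (X : Scheme.{0}) (m : ℕ)
    (h : topologicalKrullDim X ≤ ((m + 1 : ℕ) : WithBot ℕ∞)) :
    topologicalKrullDim X = ((m + 1 : ℕ) : WithBot ℕ∞) ∨
      topologicalKrullDim X ≤ (m : WithBot ℕ∞) := by
  rcases eq_or_lt_of_le h with h1 | h1
  · exact Or.inl h1
  · right
    -- `dim X < m + 1` in `WithBot ℕ∞`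
    induction hX : topologicalKrullDim X using WithBot.recBotCoe with
    | bot => exact bot_le
    | coe d =>
      rw [hX] at h1
      induction d using ENat.recTopCoe with
      | top => exact absurd h1 (not_lt_of_ge (by exact_mod_cast le_top))
      | coe d =>
        have : d < m + 1 := by exact_mod_cast h1
        exact_mod_cast Nat.lt_succ_iff.mp this

/-- **The open core at the exact level `N = dim X` implies it at every level `N ≥ dim X`.**
If for every reduced separated `X` of finite type over a field of characteristic `p` and every
maximal value `ν ≠ Φ^{(N)}` of `Σ_X` at the level `N = dim X` EXACTLY there is a blow-up sequence
with centres over `X(ν)`, `H^N` non-increasing and `ν` killed, then the same holds at every level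
`N ≥ dim X` (the statement of `stub_nuEliminationsExist`): induction on `N`, raising the level
by `nuEliminationsExist_succ` whenever `dim X < N`. [cite: CossartJannsenSaito2020, Def. 2.28, Rem. 2.29, Def. 6.14] -/
theorem nuEliminationsExist_of_level_eq_dim :
    (∀ p : ℕ, p.Prime → ∀ (k : Type) [Field k] [CharP k p] (X : Scheme.{0})
      (f : X ⟶ Spec (.of k)), IsSeparated f → LocallyOfFiniteType f → QuasiCompact f →
      IsReduced X → ∀ N : ℕ, topologicalKrullDim X = (N : WithBot ℕ∞) →
      ∀ ν : ℕ → ℕ, Maximal (· ∈ Scheme.hsValues X N) ν → ν ≠ iterPSum N Phi →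
        ∃ s : CentreSeq X, s.CentresOver (Scheme.hsStratum X N ν) ∧
          (∀ x' : s.top, Scheme.hsFun s.top N x' ≤ Scheme.hsFun X N (s.comp.base x')) ∧
          ν ∉ Scheme.hsValues s.top N) →
    ∀ p : ℕ, p.Prime → ∀ (k : Type) [Field k] [CharP k p] (X : Scheme.{0})
      (f : X ⟶ Spec (.of k)), IsSeparated f → LocallyOfFiniteType f → QuasiCompact f →
      IsReduced X → ∀ N : ℕ, topologicalKrullDim X ≤ (N : WithBot ℕ∞) →
      ∀ ν : ℕ → ℕ, Maximal (· ∈ Scheme.hsValues X N) ν → ν ≠ iterPSum N Phi →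
        ∃ s : CentreSeq X, s.CentresOver (Scheme.hsStratum X N ν) ∧
          (∀ x' : s.top, Scheme.hsFun s.top N x' ≤ Scheme.hsFun X N (s.comp.base x')) ∧
          ν ∉ Scheme.hsValues s.top N := by
  intro H
  -- the statement at level `N`, for all schemes of the class of dimension `≤ N`, by induction
  have P : ∀ N : ℕ, ∀ p : ℕ, p.Prime → ∀ (k : Type) [Field k] [CharP k p] (X : Scheme.{0})
      (f : X ⟶ Spec (.of k)), IsSeparated f → LocallyOfFiniteType f → QuasiCompact f →
      IsReduced X → topologicalKrullDim X ≤ (N : WithBot ℕ∞) →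
      ∀ ν : ℕ → ℕ, Maximal (· ∈ Scheme.hsValues X N) ν → ν ≠ iterPSum N Phi →
        ∃ s : CentreSeq X, s.CentresOver (Scheme.hsStratum X N ν) ∧
          (∀ x' : s.top, Scheme.hsFun s.top N x' ≤ Scheme.hsFun X N (s.comp.base x')) ∧
          ν ∉ Scheme.hsValues s.top N := by
    intro N
    induction N with
    | zero =>
      intro p hp k _ _ X f hsep hft hqc hred hdim ν hν hνΦ
      rcases eq_or_lt_of_le hdim with h0 | h0
      · exact H p hp k X f hsep hft hqc hred 0 h0 ν hν hνΦ
      · -- `dim X < 0` contradicts the existence of a point (a value of `H`)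
        exfalso
        obtain ⟨x, -⟩ := hν.1
        haveI : Nonempty (IrreducibleCloseds X) :=
          ⟨⟨closure {x}, isIrreducible_singleton.closure, isClosed_closure⟩⟩
        have h1 : (0 : WithBot ℕ∞) ≤ topologicalKrullDim X := Order.krullDim_nonneg
        exact absurd (h1.trans_lt (by exact_mod_cast h0)) (lt_irrefl _)
    | succ m ih =>
      intro p hp k _ _ X f hsep hft hqc hred hdim ν hν hνΦ
      rcases topologicalKrullDim_eq_or_le_of_le_succ X m hdim with h1 | h1
      · exact H p hp k X f hsep hft hqc hred (m + 1) h1 ν hν hνΦ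
      · exact nuEliminationsExist_succ m ih p hp k X f hsep hft hqc hred h1 ν hν hνΦ
  intro p hp k _ _ X f hsep hft hqc hred N
  exact P N p hp k X f hsep hft hqc hred

end Summit.ResolutionOfSingularities.ResolutionOfSingularities.Theorems.SigmaMaxModifications.Sketch

end
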